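import Summits.Langlands.Langlands.Statement
import Literature.NumberTheory.Automorphic.IsAutomorphicAE
import Literature.NumberTheory.GaloisRepresentations.ResidualGaloisRep
import Literature.NumberTheory.GaloisRepresentations.OrdinaryTwistedDeterminant
import Literature.NumberTheory.GaloisRepresentations.LabelledHodgeTateWeights
import HarnessLib
/-!
# `WeightOneFMBeyondTaylorWilesQ` — F3 SPECIAL-CASE WITNESS (G4 ladder-down generation 12 on
# `ReciprocityUpToIrreducibility`, item stmt-Langlands-14328)

DIAL κ = Taylor–Wiles depth of the weight-one (Hodge–Tate `(0,0)`) Fontaine–Mazur theorem for `GL₂/ℚ`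
at an odd prime.  This file: the family `WeightOneFM θ`, the rung `WeightOneFMBeyondTaylorWilesQ :=
WeightOneFM 1`, dial monotonicity, and the FLOOR THEOREM `floor_zero : Pan2022Floor → WeightOneFM 0`
(no `sorry`), where `Pan2022Floor` is VERBATIM (up to unfolding the two helper predicates
`IsResiduallyGenericGL2At`, `IsDeRhamWeightZeroGL2`) the named Literature fact
`Literature.NumberTheory.Automorphic.Pan2022_fontaineMazurGL2_weightOne` — Pan, Forum Math. Pi 10
(2022) Thm. 1.0.5 [cite: Pan2022LocallyAnalytic, Thm. 1.0.5] — proposed into the tree as p184515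
(file `Literature/NumberTheory/Automorphic/FontaineMazurGL2WeightOne.lean`; once landed,
`floor_zero` takes `(h : Pan2022_fontaineMazurGL2_weightOne)` by `Iff.rfl` on the clauses).
The floor instance `θ = 0` is a theorem in print; the rung `θ = 1` is not (Pan Rem. 1.0.6 / 6.4.10).
-/
noncomputable section

set_option linter.dupNamespace false

open scoped MatrixGroups Matrix NumberField Classical
open NumberField IsDedekindDomain Field Filter
open Literature.NumberTheory.Automorphic Literature.NumberTheory.GaloisRepresentations
open Literature.NumberTheory.PAdicHodge
open Summit.Langlands

namespace Summit.Langlands.Langlands.Cruxes.ReciprocityUpToIrreducibility.WeightOneFMBeyondTaylorWilesQ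

/-! ## The sector clauses -/

/-- **Weight-one sector at `p`**: `ρ|Γ_{ℚ_v}` (`v = (p)`) is DE RHAM for Fontaine's PINNED datum
`fontainePstAdicCompletion v p hv` and its `τ`-labelled Hodge–Tate weights are `{0, 0}` for every
continuous label `τ : ℚ_v → ℚ̄_p` (Pan: "`ρ|G_{ℚ_p}` is Hodge–Tate of weights `0,0`"; Hodge–Tate of
weights `0,0` ⇒ potentially unramified (Sen) ⇒ de Rham, so the de Rham clause only makes the rendered
hypothesis formally stronger). -/
def DeRhamWeightZeroAt (p : ℕ) [Fact p.Prime] (ρ : FramedGaloisRep ℚ (PadicAlgCl p) 2) : Prop :=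
  ∀ (v : HeightOneSpectrum (𝓞 ℚ)) (hv : ((p : ℕ) : 𝓞 ℚ) ∈ v.asIdeal),
    (fontainePstAdicCompletion v p hv).IsDeRhamFramed (ρ.toLocal v) ∧
    ∀ τ : v.adicCompletion ℚ →+* PadicAlgCl p, Continuous τ →
      ρ.labelledHodgeTateWeightsAt v (fontainePstAdicCompletion v p hv).algebra
        (fontainePstAdicCompletion v p hv).𝔅 τ = {0, 0}

/-- **Local genericity at `p`** (Pan 2022 Thm 1.0.5, last hypothesis): `(ρ̄|Γ_{ℚ_p})^ss` is either
irreducible or `η₁ ⊕ η₂` with `η₁/η₂ ≠ 1, ω^{±1}`.  Trace rendering (Brauer–Nesbitt, `p > 2`):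
there are NO finite-order characters `η₁, η₂ : Γ_{ℚ_v} → ℚ̄_pˣ` with `tr ρ|Γ_{ℚ_v} ≡ η₁ + η₂ (mod 𝔪)`
and `η₁ ≡ η₂`, `η₁ ≡ ε η₂` or `η₂ ≡ ε η₁ (mod 𝔪)` (`ε` = the `p`-adic cyclotomic character of
`Γ_{ℚ_v}`, `ε ≡ ω`). -/
def LocallyGenericAt (p : ℕ) [Fact p.Prime] (ρ : FramedGaloisRep ℚ (PadicAlgCl p) 2) : Prop :=
  ∀ (v : HeightOneSpectrum (𝓞 ℚ)), ((p : ℕ) : 𝓞 ℚ) ∈ v.asIdeal →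
    ¬ ∃ η₁ η₂ : absoluteGaloisGroup (v.adicCompletion ℚ) →* (PadicAlgCl p)ˣ,
      IsOpen (η₁.ker : Set (absoluteGaloisGroup (v.adicCompletion ℚ))) ∧
      IsOpen (η₂.ker : Set (absoluteGaloisGroup (v.adicCompletion ℚ))) ∧
      (∀ σ, ‖(ρ.toLocal v σ).val.trace - ((η₁ σ : PadicAlgCl p) + (η₂ σ : PadicAlgCl p))‖ < 1) ∧
      ((∀ σ, ‖(η₁ σ : PadicAlgCl p) - (η₂ σ : PadicAlgCl p)‖ < 1) ∨
       (∀ σ, ‖(η₁ σ : PadicAlgCl p) -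
          (cyclotomicPadicAlgCl (v.adicCompletion ℚ) p σ : PadicAlgCl p) * (η₂ σ : PadicAlgCl p)‖ < 1) ∨
       (∀ σ, ‖(η₂ σ : PadicAlgCl p) -
          (cyclotomicPadicAlgCl (v.adicCompletion ℚ) p σ : PadicAlgCl p) * (η₁ σ : PadicAlgCl p)‖ < 1))

/-- **The Taylor–Wiles hypothesis** (Pan 2022 Thm 1.0.5, fourth hypothesis): `ρ̄|Γ_{ℚ(μ_p)}` is
(absolutely) irreducible — the accepted predicate `FramedGaloisRep.IsResiduallyAbsIrreducible` on the
restriction to `Γ_{ℚ(ζ_p)}`, exactly as in the tree's facts `Tung2021_fontaineMazurGL2`,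
`XZhang2024_fontaineMazurGL2_tateTwist`. -/
def TaylorWilesHypothesis (p : ℕ) [Fact p.Prime] (ρ : FramedGaloisRep ℚ (PadicAlgCl p) 2) : Prop :=
  (ρ.restrictField (CyclotomicField p ℚ)).IsResiduallyAbsIrreducible

/-! ## The family and the rung -/

/-- **The rung family** `E(θ)` — Taylor–Wiles depth `θ` of the weight-one Fontaine–Mazur theorem over
`ℚ`: for every odd prime `p` and every continuous irreducible, a.e. unramified, odd
`ρ : Γ_ℚ → GL₂(ℚ̄_p)` in the weight-one sector (`DeRhamWeightZeroAt`), subject to the residual clauses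
`θ ≤ 1 →` local genericity and `θ = 0 →` Taylor–Wiles, there is an L-algebraic cuspidal `π` of
`GL₂(𝔸_ℚ)` attached to `ρ` at almost all places.  `θ = 0`: Pan 2022 Thm 1.0.5 (FLOOR, in print);
`θ = 1`: THE RUNG (open: residually reducible / cyclotomic-dihedral weight one); `θ ≥ 2`: full
weight-one Fontaine–Mazur over `ℚ` (open).
[cite: Pan2022LocallyAnalytic, Thm. 1.0.5, Rem. 1.0.6, Rem. 6.4.10] -/
def WeightOneFM (θ : ℕ) : Prop :=
  ∀ (p : ℕ) [Fact p.Prime], p ≠ 2 →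
    ∀ (hcpt : isCompact_glFiniteIntegralLevel 2 ℚ) (ι : PadicAlgCl p ≃+* ℂ)
      (ρ : FramedGaloisRep ℚ (PadicAlgCl p) 2),
      ρ.toGaloisRep.IsIrreducible →
      (∀ᶠ v : HeightOneSpectrum (𝓞 ℚ) in cofinite, ρ.IsUnramifiedAt v) →
      ρ.IsOdd →
      DeRhamWeightZeroAt p ρ →
      (θ ≤ 1 → LocallyGenericAt p ρ) →
      (θ = 0 → TaylorWilesHypothesis p ρ) →
      ∃ π : CuspidalAutomorphicRepData 2 ℚ hcpt, π.1.IsLAlgebraic ∧ SatakeFrobCompatibleAE ι π.1 ρ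

/-- **THE RUNG** (the filed statement): the family at `θ = 1` — the weight-one Fontaine–Mazur theorem
over `ℚ` WITHOUT the Taylor–Wiles hypothesis (residually reducible and cyclotomic-dihedral `ρ̄`
admitted), the local genericity at `p` kept. -/
def WeightOneFMBeyondTaylorWilesQ : Prop := WeightOneFM 1

/-! ## Dial monotonicity -/

/-- The dial is monotone: a deeper rung implies every shallower one. -/
theorem mono {θ θ' : ℕ} (hle : θ ≤ θ') (h : WeightOneFM θ') : WeightOneFM θ := by
  intro p _ hp hcpt ι ρ hirr hunr hodd hdr hgen htw
  exact h p hp hcpt ι ρ hirr hunr hodd hdr (fun h1 => hgen (by omega)) (fun h0 => htw (by omega))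

theorem mono_one_zero (h : WeightOneFMBeyondTaylorWilesQ) : WeightOneFM 0 := mono (by norm_num) h

theorem mono_two_one (h : WeightOneFM 2) : WeightOneFMBeyondTaylorWilesQ := mono (by norm_num) h

/-! ## The floor (Pan 2022 Thm 1.0.5, rendered; = the proposed Literature fact
`Literature.NumberTheory.Automorphic.Pan2022_fontaineMazurGL2_weightOne`, verbatim) -/

/-- **Pan 2022, Forum Math. Pi 10, Thm 1.0.5** (= Pilloni–Stroh 2016), rendered: `p > 2`;
`ρ : Γ_ℚ → GL₂(ℚ̄_p)` continuous, a.e. unramified, irreducible, odd, `ρ̄|Γ_{ℚ(μ_p)}` absolutely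
irreducible, locally generic at `p`, Hodge–Tate of weights `0,0` at `p` (rendered: de Rham for the pinned
datum with labelled weights `{0,0}`) ⇒ `ρ` is the Deligne–Serre representation of a classical weight-one
cuspidal eigenform (rendered: an L-algebraic cuspidal `π` of `GL₂(𝔸_ℚ)` with `SatakeFrobCompatibleAE ι π ρ`,
for every `hcpt`, `ι`). [cite: Pan2022LocallyAnalytic, Thm. 1.0.5 (= Thm. 6.4.8 + Cor. 6.4.9)] -/
def Pan2022Floor : Prop :=
  ∀ (p : ℕ) [Fact p.Prime], p ≠ 2 →
    ∀ (ρ : FramedGaloisRep ℚ (PadicAlgCl p) 2),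
      (∀ᶠ v : HeightOneSpectrum (𝓞 ℚ) in cofinite, ρ.IsUnramifiedAt v) →
      ρ.toGaloisRep.IsIrreducible → ρ.IsOdd →
      (ρ.restrictField (CyclotomicField p ℚ)).IsResiduallyAbsIrreducible →
      (∀ (v : HeightOneSpectrum (𝓞 ℚ)), ((p : ℕ) : 𝓞 ℚ) ∈ v.asIdeal →
        ¬ ∃ η₁ η₂ : absoluteGaloisGroup (v.adicCompletion ℚ) →* (PadicAlgCl p)ˣ,
          IsOpen (η₁.ker : Set (absoluteGaloisGroup (v.adicCompletion ℚ))) ∧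
          IsOpen (η₂.ker : Set (absoluteGaloisGroup (v.adicCompletion ℚ))) ∧
          (∀ σ, ‖(ρ.toLocal v σ).val.trace - ((η₁ σ : PadicAlgCl p) + (η₂ σ : PadicAlgCl p))‖ < 1) ∧
          ((∀ σ, ‖(η₁ σ : PadicAlgCl p) - (η₂ σ : PadicAlgCl p)‖ < 1) ∨
           (∀ σ, ‖(η₁ σ : PadicAlgCl p) -
              (cyclotomicPadicAlgCl (v.adicCompletion ℚ) p σ : PadicAlgCl p) * (η₂ σ : PadicAlgCl p)‖ < 1) ∨
           (∀ σ, ‖(η₂ σ : PadicAlgCl p) -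
              (cyclotomicPadicAlgCl (v.adicCompletion ℚ) p σ : PadicAlgCl p) * (η₁ σ : PadicAlgCl p)‖ < 1))) →
      (∀ (v : HeightOneSpectrum (𝓞 ℚ)) (hv : ((p : ℕ) : 𝓞 ℚ) ∈ v.asIdeal),
        (fontainePstAdicCompletion v p hv).IsDeRhamFramed (ρ.toLocal v) ∧
        ∀ τ : v.adicCompletion ℚ →+* PadicAlgCl p, Continuous τ →
          ρ.labelledHodgeTateWeightsAt v (fontainePstAdicCompletion v p hv).algebra
            (fontainePstAdicCompletion v p hv).𝔅 τ = {0, 0}) →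
      ∀ (hcpt : isCompact_glFiniteIntegralLevel 2 ℚ) (ι : PadicAlgCl p ≃+* ℂ),
        ∃ π : CuspidalAutomorphicRepData 2 ℚ hcpt, π.1.IsLAlgebraic ∧ SatakeFrobCompatibleAE ι π.1 ρ

/-- **F3 floor witness**: the floor IS the family at `θ = 0` — `Pan2022Floor → E(0)`, by passing the
binders (the clauses `DeRhamWeightZeroAt`, `LocallyGenericAt`, `TaylorWilesHypothesis` are
definitionally the fact's clauses; the guards `0 ≤ 1`, `0 = 0` are discharged by `le_rfl` / `rfl`). -/
theorem floor_zero (h : Pan2022Floor) : WeightOneFM 0 := by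
  intro p _ hp hcpt ι ρ hirr hunr hodd hdr hgen htw
  exact h p hp ρ hunr hirr hodd (htw rfl) (hgen zero_le_one) hdr hcpt ι


end Summit.Langlands.Langlands.Cruxes.ReciprocityUpToIrreducibility.WeightOneFMBeyondTaylorWilesQ

end
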